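import Mathlib.MeasureTheory.Integral.IntegralEqImproper
import Mathlib.Analysis.Calculus.MeanValue
import Mathlib.Analysis.Calculus.ContDiff.Basic
import Mathlib.Analysis.Calculus.IteratedDeriv.Lemmas
import HarnessLib

/-!
# All-axes cylinder budget, piece O1a″ (1/3): decay along a ray from an integrable weighted second
# derivative (the `(σ − s)/σ ≤ 1` trick)

Helper toward obligation O1a″ `CylinderDecayOfHessian` of the «all-axes cylinder budget» line for
`GaldiLiouvilleGate.GaldiLiouville` (stmt-NavierStokesRegularity-0895; Defs of record
`pub/ideators/ns-idea-4/lines/combined/CylinderBudgets_v3_1.lean` 817120c4c833a18a, blueprint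
«`∬|P−c|(r,·)dθdz ≤ ‖∇²P‖_{L¹(cylRadius>r)}`»). The one-dimensional heart: if `f ∈ C²(ℝ)` tends to
`c` at `+∞`, then for every `s > 0`

  `|f(s) − c| ≤ ∫_{σ>s} σ |f″(σ)| dσ`   (in `[0, ∞]`, trivially when the right side is infinite):

`f′ → 0` (mean value theorem against `f(n+1) − f(n) → 0`), `f′(b) = −∫_b^∞ f″`, so
`(b−s)|f′(b)| ≤ ∫_b^∞ σ|f″| → 0`, and `f(s) = f(b) − (b−s)f′(b) + ∫_s^b (σ−s)f″(σ)dσ` with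
`(σ−s) ≤ σ`. Applied along the rays `σ ↦ P(σω, z)` of the pressure this is the printed step
«`∂_r p ∈ L¹(P₊)`, `∫_ℝ p(t,z)dz = −∫_t^∞∫ ∂_r p → 0`» (Wang 2025, proof of Lemma 3.5, p. 50).

Theorems only, standard axioms, no `sorry`.

WHAT THIS IS NOT: not a proof of ⟨0895⟩/⟨0896⟩ nor of any NS regularity statement.
-/

set_option linter.dupNamespace false

noncomputable section

open MeasureTheory Set Filter Topology intervalIntegral
open scoped ENNReal Topology

namespace Summit.NavierStokesRegularity.NavierStokesRegularity.Theorems.GaldiLiouville.AllAxesBudget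

/-- **Decay along a ray from the weighted second derivative.** For `f ∈ C²(ℝ)` with `f → c` at
`+∞` and `s > 0`: `|f(s) − c| ≤ ∫_{σ > s} σ|f″(σ)| dσ` in `[0,∞]`. [cite: Wang2025, Lemma 3.5 (proof, p. 50: ∂_r p ∈ L¹(P₊))] -/
theorem ofReal_abs_sub_lim_le_lintegral_mul_deriv_two {f : ℝ → ℝ} (hf : ContDiff ℝ 2 f) {c s : ℝ}
    (hs : 0 < s) (hlim : Tendsto f atTop (𝓝 c)) :
    ENNReal.ofReal |f s - c| ≤
      ∫⁻ σ in Ioi s, ENNReal.ofReal (σ * |deriv (deriv f) σ|) := by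
  by_cases hI : ∫⁻ σ in Ioi s, ENNReal.ofReal (σ * |deriv (deriv f) σ|) = ∞
  · rw [hI]; exact le_top
  -- names and regularity
  set f' : ℝ → ℝ := deriv f with hf'
  set f'' : ℝ → ℝ := deriv (deriv f) with hf''
  set g : ℝ → ℝ := fun σ => σ * |f'' σ| with hg
  have hfd : Differentiable ℝ f := hf.differentiable (by norm_num)
  have hf2 : ContDiff ℝ ((1 : WithTop ℕ∞) + 1) f := by rw [one_add_one_eq_two]; exact hf
  have hf'C1 : ContDiff ℝ 1 f' := hf2.deriv'
  have hf'd : Differentiable ℝ f' := hf.differentiable_deriv_two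
  have hf''c : Continuous f'' := hf'C1.continuous_deriv le_rfl
  have hf'c : Continuous f' := hf'C1.continuous
  have hfc : Continuous f := hf.continuous
  have hgc : Continuous g := continuous_id.mul hf''c.abs
  have hg0 : ∀ σ ∈ Ioi s, 0 ≤ g σ := fun σ hσ => mul_nonneg (hs.le.trans (le_of_lt hσ)) (abs_nonneg _)
  -- integrability of `g` and `f''` on `Ioi s`
  have hgint : IntegrableOn g (Ioi s) := by
    refine ⟨hgc.aestronglyMeasurable.restrict, ?_⟩
    rw [hasFiniteIntegral_iff_enorm]
    have e : ∫⁻ σ in Ioi s, ‖g σ‖ₑ = ∫⁻ σ in Ioi s, ENNReal.ofReal (σ * |deriv (deriv f) σ|) :=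
      setLIntegral_congr_fun measurableSet_Ioi fun σ hσ => by
        rw [Real.enorm_eq_ofReal (hg0 σ hσ)]
    rw [e]; exact lt_top_iff_ne_top.2 hI
  have hf''int : ∀ b, s ≤ b → IntegrableOn f'' (Ioi b) := by
    intro b hb
    have hb0 : 0 < b := hs.trans_le hb
    refine Integrable.mono' ((hgint.mono_set (Ioi_subset_Ioi hb)).const_mul b⁻¹)
      hf''c.aestronglyMeasurable.restrict ?_
    refine (ae_restrict_iff' measurableSet_Ioi).2 (ae_of_all _ fun σ hσ => ?_)
    have hσ0 : 0 < σ := hb0.trans hσ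
    rw [Real.norm_eq_abs, hg]
    dsimp only
    rw [← mul_assoc]
    have : 1 ≤ b⁻¹ * σ := by rw [inv_mul_eq_div, one_le_div hb0]; exact le_of_lt hσ
    nlinarith [abs_nonneg (f'' σ)]
  -- Step A: `f'` has a limit `L` at `+∞`
  set L : ℝ := f' s + ∫ σ in Ioi s, f'' σ with hL
  have hFTC1 : ∀ b, s ≤ b → ∫ σ in s..b, f'' σ = f' b - f' s := fun b hb =>
    integral_eq_sub_of_hasDerivAt (fun σ _ => (hf'd σ).hasDerivAt) ((hf''c.intervalIntegrable _ _))
  have hf'lim : Tendsto f' atTop (𝓝 L) := by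
    have h1 : Tendsto (fun b => ∫ σ in s..b, f'' σ) atTop (𝓝 (∫ σ in Ioi s, f'' σ)) :=
      intervalIntegral_tendsto_integral_Ioi s (hf''int s le_rfl) tendsto_id
    have h2 : Tendsto (fun b => f' s + ∫ σ in s..b, f'' σ) atTop (𝓝 L) := tendsto_const_nhds.add h1
    refine h2.congr' ?_
    filter_upwards [eventually_ge_atTop s] with b hb
    rw [hFTC1 b hb]; ring
  -- Step B: `L = 0` (mean value theorem against `f(s+n+1) − f(s+n) → 0`)
  have hL0 : L = 0 := by
    have hmvt : ∀ n : ℕ, ∃ ξ ∈ Ioo (s + n) (s + n + 1), f' ξ = f (s + n + 1) - f (s + n) := by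
      intro n
      obtain ⟨ξ, hξ, hξeq⟩ := exists_deriv_eq_slope f (by linarith : s + n < s + n + 1)
        hfc.continuousOn hfd.differentiableOn
      refine ⟨ξ, hξ, ?_⟩
      rw [hf', hξeq]; simp
    choose ξ hξ hξeq using hmvt
    have hξtop : Tendsto ξ atTop atTop := by
      refine tendsto_atTop_mono (fun n => (hξ n).1.le) ?_
      exact tendsto_atTop_add_const_left _ _ tendsto_natCast_atTop_atTop
    have hA : Tendsto (fun n => f' (ξ n)) atTop (𝓝 L) := hf'lim.comp hξtop
    have hB : Tendsto (fun n => f' (ξ n)) atTop (𝓝 0) := by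
      have h1 : Tendsto (fun n : ℕ => f (s + n + 1)) atTop (𝓝 c) :=
        hlim.comp (tendsto_atTop_add_const_right _ _
          (tendsto_atTop_add_const_left _ _ tendsto_natCast_atTop_atTop))
      have h2 : Tendsto (fun n : ℕ => f (s + n)) atTop (𝓝 c) :=
        hlim.comp (tendsto_atTop_add_const_left _ _ tendsto_natCast_atTop_atTop)
      have h3 := h1.sub h2
      rw [sub_self] at h3
      exact h3.congr fun n => (hξeq n).symm
    exact tendsto_nhds_unique hA hB
  rw [hL0] at hf'lim
  -- Step C: `f' b = −∫_{Ioi b} f''` and `(b − s)|f' b| ≤ ∫_{Ioi b} g`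
  have hf'eq : ∀ b, s ≤ b → f' b = -∫ σ in Ioi b, f'' σ := by
    intro b hb
    have h := integral_Ioi_of_hasDerivAt_of_tendsto (hf'c.continuousWithinAt)
      (fun σ _ => (hf'd σ).hasDerivAt) (hf''int b hb) hf'lim
    rw [h]; simp
  have htail_bound : ∀ b, s ≤ b → (b - s) * |f' b| ≤ ∫ σ in Ioi b, g σ := by
    intro b hb
    have hb0 : 0 < b := hs.trans_le hb
    have h1 : |f' b| ≤ ∫ σ in Ioi b, |f'' σ| := by
      rw [hf'eq b hb, abs_neg]
      exact abs_integral_le_integral_abs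
    have h2 : b * ∫ σ in Ioi b, |f'' σ| ≤ ∫ σ in Ioi b, g σ := by
      rw [← MeasureTheory.integral_const_mul]
      refine setIntegral_mono_on ((hf''int b hb).abs.const_mul b)
        (hgint.mono_set (Ioi_subset_Ioi hb)) measurableSet_Ioi fun σ hσ => ?_
      rw [hg]; dsimp only
      exact mul_le_mul_of_nonneg_right (le_of_lt hσ) (abs_nonneg _)
    have hbs : b - s ≤ b := by linarith
    calc (b - s) * |f' b| ≤ b * |f' b| := mul_le_mul_of_nonneg_right hbs (abs_nonneg _)
      _ ≤ b * ∫ σ in Ioi b, |f'' σ| := mul_le_mul_of_nonneg_left h1 hb0.le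
      _ ≤ ∫ σ in Ioi b, g σ := h2
  -- Step D: the tail `∫_{Ioi b} g → 0`
  set I : ℝ := ∫ σ in Ioi s, g σ with hIdef
  have hsplit : ∀ b, s ≤ b → ∫ σ in Ioi b, g σ = I - ∫ σ in s..b, g σ := by
    intro b hb
    rw [hIdef, ← Ioc_union_Ioi_eq_Ioi hb, setIntegral_union (Ioc_disjoint_Ioi le_rfl)
      measurableSet_Ioi (hgint.mono_set Ioc_subset_Ioi_self) (hgint.mono_set (Ioi_subset_Ioi hb)),
      integral_of_le hb]
    ring
  have htail : Tendsto (fun b => ∫ σ in Ioi b, g σ) atTop (𝓝 0) := by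
    have h1 : Tendsto (fun b => ∫ σ in s..b, g σ) atTop (𝓝 I) :=
      intervalIntegral_tendsto_integral_Ioi s hgint tendsto_id
    have h2 : Tendsto (fun b => I - ∫ σ in s..b, g σ) atTop (𝓝 (I - I)) := tendsto_const_nhds.sub h1
    rw [sub_self] at h2
    refine h2.congr' ?_
    filter_upwards [eventually_ge_atTop s] with b hb
    rw [hsplit b hb]
  -- Step E: `f s = f b − (b − s) f' b + ∫_s^b (σ − s) f'' σ dσ`
  have hFTC2 : ∀ b, s ≤ b →
      f s = f b - (b - s) * f' b + ∫ σ in s..b, (σ - s) * f'' σ := by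
    intro b hb
    -- `F σ = f σ − (σ − s) f' σ`, `F' = −(σ − s) f''`
    have hF : ∀ σ, HasDerivAt (fun σ => f σ - (σ - s) * f' σ) (-((σ - s) * f'' σ)) σ := by
      intro σ
      have h1 : HasDerivAt f (f' σ) σ := (hfd σ).hasDerivAt
      have h2 : HasDerivAt (fun σ => σ - s) 1 σ := (hasDerivAt_id σ).sub_const s
      have h3 : HasDerivAt f' (f'' σ) σ := (hf'd σ).hasDerivAt
      have h4 := h1.sub (h2.mul h3)
      exact h4.congr_deriv (by ring)
    have hint : IntervalIntegrable (fun σ => -((σ - s) * f'' σ)) volume s b :=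
      ((continuous_id.sub continuous_const).mul hf''c).neg.intervalIntegrable _ _
    have h := integral_eq_sub_of_hasDerivAt (fun σ _ => hF σ) hint
    rw [intervalIntegral.integral_neg] at h
    simp only [sub_self, zero_mul, sub_zero] at h
    linarith
  -- the bound for finite `b`
  have hbound : ∀ b, s ≤ b → |f s - c| ≤ I + (∫ σ in Ioi b, g σ) + |f b - c| := by
    intro b hb
    have h1 : |∫ σ in s..b, (σ - s) * f'' σ| ≤ I := by
      have hle : |∫ σ in s..b, (σ - s) * f'' σ| ≤ ∫ σ in s..b, g σ := by
        rw [← Real.norm_eq_abs]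
        refine (intervalIntegral.norm_integral_le_integral_norm hb).trans
          (intervalIntegral.integral_mono_on hb
            (((continuous_id.sub continuous_const).mul hf''c).norm.intervalIntegrable _ _)
            (hgc.intervalIntegrable _ _) fun σ hσ => ?_)
        rw [Real.norm_eq_abs, abs_mul, hg]
        refine mul_le_mul_of_nonneg_right ?_ (abs_nonneg _)
        rw [abs_of_nonneg (by linarith [hσ.1])]; linarith [hσ.1]
      have hle2 : ∫ σ in s..b, g σ ≤ I := by
        rw [hIdef, integral_of_le hb]
        exact setIntegral_mono_set hgint
          ((ae_restrict_iff' measurableSet_Ioi).2 (ae_of_all _ fun σ hσ => hg0 σ hσ))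
          (ae_of_all _ Ioc_subset_Ioi_self)
      exact hle.trans hle2
    have h2 := htail_bound b hb
    have h3 := hFTC2 b hb
    have : f s - c = (f b - c) - (b - s) * f' b + ∫ σ in s..b, (σ - s) * f'' σ := by linarith
    rw [this]
    calc |f b - c - (b - s) * f' b + ∫ σ in s..b, (σ - s) * f'' σ|
        ≤ |f b - c - (b - s) * f' b| + |∫ σ in s..b, (σ - s) * f'' σ| := abs_add_le _ _
      _ ≤ (|f b - c| + |(b - s) * f' b|) + I := add_le_add (abs_sub _ _) h1
      _ = |f b - c| + (b - s) * |f' b| + I := by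
          rw [abs_mul, abs_of_nonneg (by linarith : 0 ≤ b - s)]
      _ ≤ |f b - c| + (∫ σ in Ioi b, g σ) + I := by linarith
      _ = I + (∫ σ in Ioi b, g σ) + |f b - c| := by ring
  -- `b → ∞`
  have hlimit : Tendsto (fun b => I + (∫ σ in Ioi b, g σ) + |f b - c|) atTop (𝓝 (I + 0 + 0)) := by
    refine (tendsto_const_nhds.add htail).add ?_
    have h := (hlim.sub_const c).abs
    rwa [sub_self, abs_zero] at h
  rw [add_zero, add_zero] at hlimit
  have hreal : |f s - c| ≤ I :=
    ge_of_tendsto hlimit (eventually_atTop.2 ⟨s, fun b hb => hbound b hb⟩)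
  -- back to `[0, ∞]`
  calc ENNReal.ofReal |f s - c| ≤ ENNReal.ofReal I := ENNReal.ofReal_le_ofReal hreal
    _ = ∫⁻ σ in Ioi s, ENNReal.ofReal (σ * |deriv (deriv f) σ|) := by
        rw [hIdef, ofReal_integral_eq_lintegral_ofReal hgint
          ((ae_restrict_iff' measurableSet_Ioi).2 (ae_of_all _ fun σ hσ => hg0 σ hσ))]

end Summit.NavierStokesRegularity.NavierStokesRegularity.Theorems.GaldiLiouville.AllAxesBudget

end
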